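import Mathlib
import Summits.Ventures.PercRepro2.Defs
import Summits.Ventures.PercRepro2.Harris
import Summits.Ventures.PercRepro2.Graph
import Summits.Ventures.PercRepro2.Events
import Summits.Ventures.PercRepro2.PsiPinInduction
import Summits.Ventures.PercRepro2.PsiUniSure
import Summits.Ventures.PercRepro2.PsiUniExplored
import Summits.Ventures.PercRepro2.PsiTEdge
import Summits.Ventures.PercRepro2.R21PinInduction
import Summits.Ventures.PercRepro2.R21OEdgeSGraph

/-!
# The edge to `y` of the `o`-exploration: (UNI-R_o) from a strengthened (R2-1) (PercRepro2, p2)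

Third far-end case of the one-edge hypothesis of `r21_slack_nonneg_of_uni_o`.  For an unpinned edge
`f = {x, y}` with `x` in the explored `o`-component, opening `f` merges the clusters of `o` and `y`:
`ℓ` becomes sure, `𝟙` becomes `𝟙 ∩ hᶜ`, `h` becomes `h ∪ S` (`S = {s ↔ y}`), `a` becomes
`a ∪ (h ∩ Y_u) ∪ (S ∩ O_u)`; the open-world slack is `R¹ = 0` and the symmetric mixed term satisfies

  `T_f − R⁰ = D_y := δ·P(𝟙 hᶜ ℓᶜ) + P(h 𝟙)·P(hᶜ S a) − P(a h 𝟙)·P(hᶜ S)`,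
  `δ = P(aᶜ h Y_u) + P(aᶜ S O_u)`,

a closed-world quantity of EITHER sign (P2-G19-YCLUSTER.md §3d″).  Hence the `y`-edge satisfies
`2·min(R⁰, R¹) ≤ T_f` as soon as the closed world satisfies the strengthened inequality
**(R2-1⁺)**: `0 ≤ R + D_y` — census-true on 0 / 27,450 instances (kit j298851 / j298852) and the
statement of record for this case.

* `conn_update_true_s_iff_y`, `conn_update_true_y_o_of_x` — the open world of the `y`-edge;
* `yEdge_transfer` — the nine open-world masses as closed-world masses;
* `yEdge_masses` — the closed-world relations;
* `r21_uni_o_edge_y_of_plus` — **(R2-1⁺) at the closed world ⟹ (UNI-R_o) at the `y`-edge**.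
-/

namespace Summit.Ventures.PercRepro2

section YEdgeGraph

variable {V : Type*} {E : Type*} [DecidableEq E] {R : Type*} [CommRing R] [LinearOrder R]

/-- With `f = {x, y}` open and `x` in the explored `o`-component, `s ↔ v` iff `s ↔ v`, or `s ↔ o` and
`y ↔ v`, or `s ↔ y` and `o ↔ v`, in the closed world. -/
lemma conn_update_true_s_iff_y {ends : E → Sym2 V} {p : E → R} {ω : Config E} {f : E} {x s o y : V}
    (hf : ends f = s(x, y)) (hx : Conn ends (fun e => decide (p e = 1)) o x)
    (hpf : p f ≠ 1) (h1 : ∀ e, e ≠ f → p e = 1 → ω e = true) (v : V) :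
    Conn ends (Function.update ω f true) s v ↔
      Conn ends (Function.update ω f false) s v ∨
        (Conn ends (Function.update ω f false) s o ∧ Conn ends (Function.update ω f false) y v) ∨
        (Conn ends (Function.update ω f false) s y ∧ Conn ends (Function.update ω f false) o v) := by
  rw [conn_update_true_iff_or hf, conn_x_iff_o hx hpf h1]
  have hsx : Conn ends (Function.update ω f false) s x ↔ Conn ends (Function.update ω f false) s o :=
    ⟨fun h => conn_symm ((conn_x_iff_o hx hpf h1 s).1 (conn_symm h)),
     fun h => conn_symm ((conn_x_iff_o hx hpf h1 s).2 (conn_symm h))⟩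
  rw [hsx]

/-- With `f = {x, y}` open and `x` in the explored `o`-component, `y ↔ o` is sure. -/
lemma conn_update_true_y_o_of_x {ends : E → Sym2 V} {p : E → R} {ω : Config E} {f : E} {x o y : V}
    (hf : ends f = s(x, y)) (hx : Conn ends (fun e => decide (p e = 1)) o x)
    (hpf : p f ≠ 1) (h1 : ∀ e, e ≠ f → p e = 1 → ω e = true) :
    Conn ends (Function.update ω f true) y o := by
  rw [conn_update_true_iff_or hf]
  exact Or.inr (Or.inr ⟨conn_refl _ _ _, (conn_x_iff_o hx hpf h1 o).2 (conn_refl _ _ _)⟩)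

end YEdgeGraph

section YEdgeProb

variable {V : Type*} {E : Type*} [Fintype E] [DecidableEq E]
  {R : Type*} [CommRing R] [LinearOrder R] [IsStrictOrderedRing R]

omit [IsStrictOrderedRing R] in
/-- The nine masses of the open world `p[f↦1]` for `f = {x, y}`, `x` in the explored `o`-component,
as closed-world masses. -/
lemma yEdge_transfer (p : E → R) (ends : E → Sym2 V) (s y o u x : V) (f : E)
    (hf : ends f = s(x, y)) (hx : Conn ends (fun e => decide (p e = 1)) o x) (hpf : p f ≠ 1) :
    prob (Function.update p f 1) (connEvent ends s u ∩ clusterInEvent ends s {W : Set V | o ∈ W} ∩ (connEvent ends s y)ᶜ) = 0 ∧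
      prob (Function.update p f 1) (connEvent ends s u ∩ connEvent ends y o ∩ (connEvent ends s y)ᶜ) =
        prob (Function.update p f 0) (connEvent ends s u ∩ (connEvent ends s y)ᶜ ∩ (connEvent ends s o)ᶜ) ∧
      prob (Function.update p f 1) (connEvent ends s y)ᶜ =
        prob (Function.update p f 0) ((connEvent ends s y)ᶜ ∩ (connEvent ends s o)ᶜ) ∧
      prob (Function.update p f 1) (connEvent ends s u ∩ clusterInEvent ends s {W : Set V | o ∈ W}) =
        prob (Function.update p f 0) ((connEvent ends s u ∪ connEvent ends s o ∩ connEvent ends y u ∪ connEvent ends s y ∩ connEvent ends o u) ∩ (connEvent ends s o ∪ connEvent ends s y)) ∧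
      prob (Function.update p f 1) (connEvent ends s u ∩ (connEvent ends s y)ᶜ) =
        prob (Function.update p f 0) (connEvent ends s u ∩ (connEvent ends s y)ᶜ ∩ (connEvent ends s o)ᶜ) ∧
      prob (Function.update p f 1) (clusterInEvent ends s {W : Set V | o ∈ W}) =
        prob (Function.update p f 0) (connEvent ends s o ∪ connEvent ends s y) ∧
      prob (Function.update p f 1) (clusterInEvent ends s {W : Set V | o ∈ W} ∩ (connEvent ends s y)ᶜ) = 0 ∧
      prob (Function.update p f 1) (connEvent ends s u) = prob (Function.update p f 0) (connEvent ends s u ∪ connEvent ends s o ∩ connEvent ends y u ∪ connEvent ends s y ∩ connEvent ends o u) ∧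
      prob (Function.update p f 1) (connEvent ends y o ∩ (connEvent ends s y)ᶜ) =
        prob (Function.update p f 0) ((connEvent ends s y)ᶜ ∩ (connEvent ends s o)ᶜ) := by
  have key : ∀ (A A' : Set (Config E)),
      (∀ ω : Config E, (∀ e, e ≠ f → p e = 1 → ω e = true) →
        (Function.update ω f true ∈ A ↔ Function.update ω f false ∈ A')) →
      prob (Function.update p f 1) A = prob (Function.update p f 0) A' :=
    fun A A' h => prob_update_one_eq_prob_update_zero_of_respects p f fun ω _ h1 => h ω h1
  have h0 : prob (Function.update p f 0) (∅ : Set (Config E)) = 0 := prob_empty _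
  have hsv : ∀ (ω : Config E), (∀ e, e ≠ f → p e = 1 → ω e = true) → ∀ v,
      Conn ends (Function.update ω f true) s v ↔
        Conn ends (Function.update ω f false) s v ∨
          (Conn ends (Function.update ω f false) s o ∧ Conn ends (Function.update ω f false) y v) ∨
          (Conn ends (Function.update ω f false) s y ∧ Conn ends (Function.update ω f false) o v) :=
    fun ω h1 v => conn_update_true_s_iff_y hf hx hpf h1 v
  have hyo : ∀ (ω : Config E), (∀ e, e ≠ f → p e = 1 → ω e = true) →
      Conn ends (Function.update ω f true) y o := fun ω h1 => conn_update_true_y_o_of_x hf hx hpf h1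
  -- the three basic open-world events
  have hh : ∀ (ω : Config E), (∀ e, e ≠ f → p e = 1 → ω e = true) →
      (Conn ends (Function.update ω f true) s o ↔
        Conn ends (Function.update ω f false) s o ∨ Conn ends (Function.update ω f false) s y) := by
    intro ω h1
    rw [hsv ω h1 o]
    constructor
    · rintro (h | ⟨hso, _⟩ | ⟨hsy, _⟩)
      · exact Or.inl h
      · exact Or.inl hso
      · exact Or.inr hsy
    · rintro (h | h)
      · exact Or.inl h
      · exact Or.inr (Or.inr ⟨h, conn_refl _ _ _⟩)
  have hQ : ∀ (ω : Config E), (∀ e, e ≠ f → p e = 1 → ω e = true) →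
      (¬ Conn ends (Function.update ω f true) s y ↔
        ¬ Conn ends (Function.update ω f false) s y ∧ ¬ Conn ends (Function.update ω f false) s o) := by
    intro ω h1
    rw [hsv ω h1 y]
    constructor
    · intro h
      exact ⟨fun hsy => h (Or.inl hsy), fun hso => h (Or.inr (Or.inl ⟨hso, conn_refl _ _ _⟩))⟩
    · rintro ⟨hsy, hso⟩ (h | ⟨h, _⟩ | ⟨h, _⟩)
      · exact hsy h
      · exact hso h
      · exact hsy h
  refine ⟨?_, ?_, ?_, ?_, ?_, ?_, ?_, ?_, ?_⟩
  · refine (key _ ∅ fun ω h1 => ?_).trans h0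
    simp only [Set.mem_inter_iff, mem_connEvent, mem_clusterInEvent, Set.mem_setOf_eq, mem_cluster,
      Set.mem_compl_iff, hh ω h1, hQ ω h1, Set.mem_empty_iff_false, iff_false]
    rintro ⟨⟨_, hso | hsy⟩, hsy', hso'⟩
    · exact hso' hso
    · exact hsy' hsy
  · refine key _ _ fun ω h1 => ?_
    simp only [Set.mem_inter_iff, mem_connEvent, Set.mem_compl_iff, hsv ω h1 u, hyo ω h1, and_true,
      hQ ω h1]
    constructor
    · rintro ⟨hsu | ⟨hso, _⟩ | ⟨hsy, _⟩, hsy', hso'⟩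
      · exact ⟨⟨hsu, hsy'⟩, hso'⟩
      · exact absurd hso hso'
      · exact absurd hsy hsy'
    · rintro ⟨⟨hsu, hsy⟩, hso⟩
      exact ⟨Or.inl hsu, hsy, hso⟩
  · refine key _ _ fun ω h1 => ?_
    simp only [Set.mem_inter_iff, mem_connEvent, Set.mem_compl_iff, hQ ω h1]
  · refine key _ _ fun ω h1 => ?_
    simp only [Set.mem_inter_iff, mem_connEvent, mem_clusterInEvent, Set.mem_setOf_eq, mem_cluster,
      Set.mem_union, hsv ω h1 u, hh ω h1, or_assoc]
  · refine key _ _ fun ω h1 => ?_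
    simp only [Set.mem_inter_iff, mem_connEvent, Set.mem_compl_iff, hsv ω h1 u, hQ ω h1]
    constructor
    · rintro ⟨hsu | ⟨hso, _⟩ | ⟨hsy, _⟩, hsy', hso'⟩
      · exact ⟨⟨hsu, hsy'⟩, hso'⟩
      · exact absurd hso hso'
      · exact absurd hsy hsy'
    · rintro ⟨⟨hsu, hsy⟩, hso⟩
      exact ⟨Or.inl hsu, hsy, hso⟩
  · refine key _ _ fun ω h1 => ?_
    simp only [mem_clusterInEvent, Set.mem_setOf_eq, mem_cluster, Set.mem_union, mem_connEvent,
      hh ω h1]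
  · refine (key _ ∅ fun ω h1 => ?_).trans h0
    simp only [Set.mem_inter_iff, mem_connEvent, mem_clusterInEvent, Set.mem_setOf_eq, mem_cluster,
      Set.mem_compl_iff, hh ω h1, hQ ω h1, Set.mem_empty_iff_false, iff_false]
    rintro ⟨hso | hsy, hsy', hso'⟩
    · exact hso' hso
    · exact hsy' hsy
  · refine key _ _ fun ω h1 => ?_
    simp only [mem_connEvent, Set.mem_union, Set.mem_inter_iff, hsv ω h1 u, or_assoc]
  · refine key _ _ fun ω h1 => ?_
    simp only [Set.mem_inter_iff, mem_connEvent, Set.mem_compl_iff, hyo ω h1, true_and, hQ ω h1]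

end YEdgeProb


section YEdgeMain

variable {V : Type*} {E : Type*} [Fintype E] [DecidableEq E]
  {R : Type*} [CommRing R] [LinearOrder R] [IsStrictOrderedRing R]

omit [LinearOrder R] [IsStrictOrderedRing R] in
/-- Closed-world relations for the `y`-edge: the open-world masses `P(a¹)`, `P(a¹ ∩ h¹)`, `P(h¹)` and the
events of `D_y` in terms of the nine closed masses and `δ = P(aᶜ h Y_u) + P(aᶜ S O_u)`. -/
lemma yEdge_masses (q : E → R) (ends : E → Sym2 V) (s y o u : V) :
    prob q ((connEvent ends s u ∪ connEvent ends s o ∩ connEvent ends y u ∪ connEvent ends s y ∩ connEvent ends o u) ∩ (connEvent ends s o ∪ connEvent ends s y)) =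
        prob q (connEvent ends s u ∪ connEvent ends s o ∩ connEvent ends y u ∪ connEvent ends s y ∩ connEvent ends o u) - prob q (connEvent ends s u ∩ (connEvent ends s y)ᶜ ∩ (connEvent ends s o)ᶜ) ∧
      prob q (connEvent ends s u ∪ connEvent ends s o ∩ connEvent ends y u ∪ connEvent ends s y ∩ connEvent ends o u) = prob q (connEvent ends s u) +
        (prob q ((connEvent ends s u)ᶜ ∩ connEvent ends s o ∩ connEvent ends y u) +
          prob q ((connEvent ends s u)ᶜ ∩ connEvent ends s y ∩ connEvent ends o u)) ∧
      prob q (connEvent ends s o ∪ connEvent ends s y) =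
        1 - prob q ((connEvent ends s y)ᶜ ∩ (connEvent ends s o)ᶜ) ∧
      prob q (connEvent ends s y)ᶜ = prob q (connEvent ends s o ∩ (connEvent ends s y)ᶜ) +
        prob q ((connEvent ends s y)ᶜ ∩ (connEvent ends s o)ᶜ) ∧
      prob q (connEvent ends s u ∩ (connEvent ends s y)ᶜ) =
        prob q (connEvent ends s u ∩ connEvent ends s o ∩ (connEvent ends s y)ᶜ) +
          prob q (connEvent ends s u ∩ (connEvent ends s y)ᶜ ∩ (connEvent ends s o)ᶜ) ∧
      prob q ((connEvent ends s o)ᶜ ∩ connEvent ends s y) =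
        1 - prob q (connEvent ends s o) - prob q ((connEvent ends s y)ᶜ ∩ (connEvent ends s o)ᶜ) ∧
      prob q ((connEvent ends s o)ᶜ ∩ connEvent ends s y ∩ connEvent ends s u) =
        prob q (connEvent ends s u) - prob q (connEvent ends s u ∩ connEvent ends s o) -
          prob q (connEvent ends s u ∩ (connEvent ends s y)ᶜ ∩ (connEvent ends s o)ᶜ) ∧
      prob q ((connEvent ends s y)ᶜ ∩ (connEvent ends s o)ᶜ ∩ (connEvent ends y o)ᶜ) =
        prob q ((connEvent ends s y)ᶜ ∩ (connEvent ends s o)ᶜ) -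
          prob q (connEvent ends y o ∩ (connEvent ends s y)ᶜ) := by
  have hsplit : ∀ (A B : Set (Config E)), prob q A = prob q (A ∩ B) + prob q (A ∩ Bᶜ) :=
    fun A B => (prob_inter_add_prob_inter_compl q A B).symm
  refine ⟨?_, ?_, ?_, ?_, ?_, ?_, ?_, ?_⟩
  · -- P(a¹ ∩ h¹) = P(a¹) − P(a¹ ∩ (h¹)ᶜ), and a¹ ∩ (h¹)ᶜ = a ∩ 𝟙 ∩ hᶜ
    rw [hsplit (connEvent ends s u ∪ connEvent ends s o ∩ connEvent ends y u ∪ connEvent ends s y ∩ connEvent ends o u) (connEvent ends s o ∪ connEvent ends s y)]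
    have : (connEvent ends s u ∪ connEvent ends s o ∩ connEvent ends y u ∪ connEvent ends s y ∩ connEvent ends o u) ∩ (connEvent ends s o ∪ connEvent ends s y)ᶜ =
        connEvent ends s u ∩ (connEvent ends s y)ᶜ ∩ (connEvent ends s o)ᶜ := by
      ext ω
      simp only [Set.mem_inter_iff, Set.mem_union, Set.mem_compl_iff, mem_connEvent, not_or]
      constructor
      · rintro ⟨(hsu | ⟨hso, _⟩) | ⟨hsy, _⟩, hso', hsy'⟩
        · exact ⟨⟨hsu, hsy'⟩, hso'⟩
        · exact absurd hso hso'
        · exact absurd hsy hsy'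
      · rintro ⟨⟨hsu, hsy⟩, hso⟩
        exact ⟨Or.inl (Or.inl hsu), hso, hsy⟩
    rw [this]; ring
  · -- P(a¹) = P(a) + P(aᶜ ∩ a¹), and aᶜ ∩ a¹ splits along h / S
    rw [hsplit (connEvent ends s u ∪ connEvent ends s o ∩ connEvent ends y u ∪ connEvent ends s y ∩ connEvent ends o u) (connEvent ends s u)]
    have h1 : (connEvent ends s u ∪ connEvent ends s o ∩ connEvent ends y u ∪ connEvent ends s y ∩ connEvent ends o u) ∩ connEvent ends s u = connEvent ends s u := by
      ext ω
      simp only [Set.mem_inter_iff, Set.mem_union, mem_connEvent]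
      exact ⟨fun h => h.2, fun h => ⟨Or.inl (Or.inl h), h⟩⟩
    have h2 : (connEvent ends s u ∪ connEvent ends s o ∩ connEvent ends y u ∪ connEvent ends s y ∩ connEvent ends o u) ∩ (connEvent ends s u)ᶜ =
        (connEvent ends s u)ᶜ ∩ connEvent ends s o ∩ connEvent ends y u ∪
          (connEvent ends s u)ᶜ ∩ connEvent ends s y ∩ connEvent ends o u := by
      ext ω
      simp only [Set.mem_inter_iff, Set.mem_union, Set.mem_compl_iff, mem_connEvent]
      constructor
      · rintro ⟨(hsu | ⟨hso, hyu⟩) | ⟨hsy, hou⟩, hsu'⟩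
        · exact absurd hsu hsu'
        · exact Or.inl ⟨⟨hsu', hso⟩, hyu⟩
        · exact Or.inr ⟨⟨hsu', hsy⟩, hou⟩
      · rintro (⟨⟨hsu', hso⟩, hyu⟩ | ⟨⟨hsu', hsy⟩, hou⟩)
        · exact ⟨Or.inl (Or.inr ⟨hso, hyu⟩), hsu'⟩
        · exact ⟨Or.inr ⟨hsy, hou⟩, hsu'⟩
    have hdisj : Disjoint ((connEvent ends s u)ᶜ ∩ connEvent ends s o ∩ connEvent ends y u)
        ((connEvent ends s u)ᶜ ∩ connEvent ends s y ∩ connEvent ends o u) := by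
      rw [Set.disjoint_left]
      rintro ω ⟨⟨hsu, _⟩, hyu⟩ ⟨⟨_, hsy⟩, _⟩
      simp only [Set.mem_compl_iff, mem_connEvent] at hsu hyu hsy
      exact hsu (conn_trans hsy hyu)
    rw [h1, h2, prob_union_of_disjoint q hdisj]
  · -- P(h ∪ S) = 1 − P(𝟙 ∩ hᶜ)
    have h := prob_compl q (connEvent ends s o ∪ connEvent ends s y)
    rw [Set.compl_union, Set.inter_comm] at h
    linear_combination h
  · -- P(𝟙) = P(h ∩ 𝟙) + P(𝟙 ∩ hᶜ)
    rw [hsplit (connEvent ends s y)ᶜ (connEvent ends s o), Set.inter_comm (connEvent ends s y)ᶜ]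
  · rw [hsplit (connEvent ends s u ∩ (connEvent ends s y)ᶜ) (connEvent ends s o),
      Set.inter_right_comm]
  · -- P(hᶜ ∩ S) = P(hᶜ) − P(hᶜ ∩ 𝟙)
    have h := hsplit (connEvent ends s o)ᶜ (connEvent ends s y)
    rw [prob_compl, Set.inter_comm (connEvent ends s o)ᶜ (connEvent ends s y)ᶜ] at h
    linear_combination -h
  · -- P(hᶜ S a) = P(a hᶜ) − P(a hᶜ 𝟙), P(a hᶜ) = P(a) − P(a h)
    have h1 := hsplit (connEvent ends s u) (connEvent ends s o)
    have h2 := hsplit (connEvent ends s u ∩ (connEvent ends s o)ᶜ) (connEvent ends s y)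
    rw [show connEvent ends s u ∩ (connEvent ends s o)ᶜ ∩ (connEvent ends s y)ᶜ =
          connEvent ends s u ∩ (connEvent ends s y)ᶜ ∩ (connEvent ends s o)ᶜ by
            ext ω; simp only [Set.mem_inter_iff]; tauto,
      show connEvent ends s u ∩ (connEvent ends s o)ᶜ ∩ connEvent ends s y =
          (connEvent ends s o)ᶜ ∩ connEvent ends s y ∩ connEvent ends s u by
            ext ω; simp only [Set.mem_inter_iff]; tauto] at h2
    linear_combination -h1 - h2
  · -- P(𝟙 hᶜ ℓᶜ) = P(𝟙 hᶜ) − P(𝟙 hᶜ ℓ), and 𝟙 ∩ hᶜ ∩ ℓ = ℓ ∩ 𝟙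
    rw [hsplit ((connEvent ends s y)ᶜ ∩ (connEvent ends s o)ᶜ) (connEvent ends y o)]
    have : (connEvent ends s y)ᶜ ∩ (connEvent ends s o)ᶜ ∩ connEvent ends y o =
        connEvent ends y o ∩ (connEvent ends s y)ᶜ := by
      ext ω
      simp only [Set.mem_inter_iff, Set.mem_compl_iff, mem_connEvent]
      constructor
      · rintro ⟨⟨hsy, _⟩, hyo⟩
        exact ⟨hyo, hsy⟩
      · rintro ⟨hyo, hsy⟩
        exact ⟨⟨hsy, fun hso => hsy (conn_trans hso (conn_symm hyo))⟩, hyo⟩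
    rw [this]; ring

/-- The arithmetic of the `y`-edge: `R¹ = 0` and `T = R⁰ + D` give `2·min(R⁰, R¹) ≤ T` from `0 ≤ R⁰ + D`. -/
lemma two_mul_min_le_of_plus {R0 R1 T D : R} (h1 : R1 = 0) (hT : T = R0 + D) (hplus : 0 ≤ R0 + D) :
    2 * min R0 R1 ≤ T := by
  subst h1
  rw [hT]
  rcases le_total R0 0 with h | h
  · rw [min_eq_left h]; linarith
  · rw [min_eq_right h]; linarith

/-- **(R2-1⁺) at the closed world ⟹ (UNI-R_o) at the `y`-edge.**  For an unpinned edge `f = {x, y}`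
with `x` in the explored `o`-component, if the closed world `p[f↦0]` satisfies the strengthened
inequality `0 ≤ R + D_y` then `2·min(R(p[f↦0]), R(p[f↦1])) ≤ T_f(p)`; here `R(p[f↦1]) = 0` and
`T_f − R(p[f↦0]) = D_y` identically. -/
theorem r21_uni_o_edge_y_of_plus (p : E → R) (ends : E → Sym2 V) (s y o u x : V) (f : E)
    (hf : ends f = s(x, y)) (hx : Conn ends (fun e => decide (p e = 1)) o x) (hpf : p f ≠ 1)
    (hplus : 0 ≤ (prob (Function.update p f 0) (connEvent ends s u ∩ clusterInEvent ends s {W : Set V | o ∈ W} ∩ (connEvent ends s y)ᶜ) + prob (Function.update p f 0) (connEvent ends s u ∩ connEvent ends y o ∩ (connEvent ends s y)ᶜ) + prob (Function.update p f 0) ((connEvent ends s y)ᶜ) * prob (Function.update p f 0) (connEvent ends s u ∩ clusterInEvent ends s {W : Set V | o ∈ W}) - (prob (Function.update p f 0) (connEvent ends s u ∩ (connEvent ends s y)ᶜ) * prob (Function.update p f 0) (clusterInEvent ends s {W : Set V | o ∈ W}) + prob (Function.update p f 0) (clusterInEvent ends s {W : Set V | o ∈ W} ∩ (connEvent ends s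 y)ᶜ) * prob (Function.update p f 0) (connEvent ends s u) + prob (Function.update p f 0) (connEvent ends y o ∩ (connEvent ends s y)ᶜ) * prob (Function.update p f 0) (connEvent ends s u))) + ((prob (Function.update p f 0) ((connEvent ends s u)ᶜ ∩ connEvent ends s o ∩ connEvent ends y u) + prob (Function.update p f 0) ((connEvent ends s u)ᶜ ∩ connEvent ends s y ∩ connEvent ends o u)) * prob (Function.update p f 0) ((connEvent ends s y)ᶜ ∩ (connEvent ends s o)ᶜ ∩ (connEvent ends y o)ᶜ) + prob (Function.update p f 0) (connEvent ends s o ∩ (connEvent ends s y)ᶜ) * prob (Function.update p f 0) ((connEvent ends s o)ᶜ ∩ connEvent ends s y ∩ connEvent ends s u) - prob (Function.update p f 0) (connEvent ends s u ∩ connEvent ends s o ∩ (connEvent ends s y)ᶜ) * prob (Function.update p f 0) ((connEvent ends s o)ᶜ ∩ connEvent ends s y))) :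
    2 * min ((prob (Function.update p f 0) (connEvent ends s u ∩ clusterInEvent ends s {W : Set V | o ∈ W} ∩ (connEvent ends s y)ᶜ) + prob (Function.update p f 0) (connEvent ends s u ∩ connEvent ends y o ∩ (connEvent ends s y)ᶜ) + prob (Function.update p f 0) ((connEvent ends s y)ᶜ) * prob (Function.update p f 0) (connEvent ends s u ∩ clusterInEvent ends s {W : Set V | o ∈ W}) - (prob (Function.update p f 0) (connEvent ends s u ∩ (connEvent ends s y)ᶜ) * prob (Function.update p f 0) (clusterInEvent ends s {W : Set V | o ∈ W}) + prob (Function.update p f 0) (clusterInEvent ends s {W : Set V | o ∈ W} ∩ (connEvent ends s y)ᶜ) * prob (Function.update p f 0) (connEvent ends s u) + prob (Function.update p f 0) (connEvent ends y o ∩ (connEvent ends s y)ᶜ) * prob (Function.update p f 0) (connEvent ends s u)))) ((prob (Function.update p f 1) (connEvent ends s u ∩ clusterInEvent ends s {W : Set V | o ∈ W} ∩ (connEvent ends s y)ᶜ) + prob (Function.update p f 1) (connEvent ends s u ∩ connEvent ends y o ∩ (connEvent ends s y)ᶜ) + prob (Function.update p f 1) ((connEvent ends s y)ᶜ) * prob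 (Function.update p f 1) (connEvent ends s u ∩ clusterInEvent ends s {W : Set V | o ∈ W}) - (prob (Function.update p f 1) (connEvent ends s u ∩ (connEvent ends s y)ᶜ) * prob (Function.update p f 1) (clusterInEvent ends s {W : Set V | o ∈ W}) + prob (Function.update p f 1) (clusterInEvent ends s {W : Set V | o ∈ W} ∩ (connEvent ends s y)ᶜ) * prob (Function.update p f 1) (connEvent ends s u) + prob (Function.update p f 1) (connEvent ends y o ∩ (connEvent ends s y)ᶜ) * prob (Function.update p f 1) (connEvent ends s u)))) ≤ (prob (Function.update p f 0) (connEvent ends s u ∩ clusterInEvent ends s {W : Set V | o ∈ W} ∩ (connEvent ends s y)ᶜ) + prob (Function.update p f 1) (connEvent ends s u ∩ clusterInEvent ends s {W : Set V | o ∈ W} ∩ (connEvent ends s y)ᶜ) + prob (Function.update p f 0) (connEvent ends s u ∩ connEvent ends y o ∩ (connEvent ends s y)ᶜ) + prob (Function.update p f 1) (connEvent ends s u ∩ connEvent ends y o ∩ (connEvent ends s y)ᶜ) + prob (Function.update p f 0) ((connEvent ends s y)ᶜ) * prob (Function.update p f 1) (connEvent ends s u ∩ clusterInEvent ends s {W :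 Set V | o ∈ W}) + prob (Function.update p f 1) ((connEvent ends s y)ᶜ) * prob (Function.update p f 0) (connEvent ends s u ∩ clusterInEvent ends s {W : Set V | o ∈ W}) - (prob (Function.update p f 0) (connEvent ends s u ∩ (connEvent ends s y)ᶜ) * prob (Function.update p f 1) (clusterInEvent ends s {W : Set V | o ∈ W}) + prob (Function.update p f 1) (connEvent ends s u ∩ (connEvent ends s y)ᶜ) * prob (Function.update p f 0) (clusterInEvent ends s {W : Set V | o ∈ W}) + prob (Function.update p f 0) (clusterInEvent ends s {W : Set V | o ∈ W} ∩ (connEvent ends s y)ᶜ) * prob (Function.update p f 1) (connEvent ends s u) + prob (Function.update p f 1) (clusterInEvent ends s {W : Set V | o ∈ W} ∩ (connEvent ends s y)ᶜ) * prob (Function.update p f 0) (connEvent ends s u) + prob (Function.update p f 0) (connEvent ends y o ∩ (connEvent ends s y)ᶜ) * prob (Function.update p f 1) (connEvent ends s u) + prob (Function.update p f 1) (connEvent ends y o ∩ (connEvent ends s y)ᶜ) * prob (Function.update p f 0) (connEvent ends s u))) := by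
  obtain ⟨t1, t2, t3, t4, t5, t6, t7, t8, t9⟩ := yEdge_transfer p ends s y o u x f hf hx hpf
  obtain ⟨m1, m2, m3, m4, m5, m6, m7, m8⟩ := yEdge_masses (Function.update p f 0) ends s y o u
  have hh : clusterInEvent ends s {W : Set V | o ∈ W} = connEvent ends s o :=
    clusterInEvent_mem_eq_connEvent_ycl ends s o
  rw [hh] at t1 t4 t6 t7 hplus ⊢
  rw [t1, t2, t3, t4, t5, t6, t7, t8, t9, m1, m2, m3]
  rw [m4, m5] at hplus ⊢
  rw [m6, m7, m8] at hplus
  refine two_mul_min_le_of_plus ?_ ?_ hplus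
  · ring
  · ring

end YEdgeMain

end Summit.Ventures.PercRepro2
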